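import Literature.NumberTheory.Sieve.CFSemigroupLipSpace
import Literature.NumberTheory.Sieve.CFSemigroupTransferComplex
import HarnessLib

/-!
# The transfer operators `L_s` as bounded operators on the Lipschitz space

Support file (all results proved) for the named fact
`Literature.NumberTheory.Sieve.MageeOhWinter2019_uniformCounting` (`CFSemigroupCounting.lean`).
[MageeOhWinter2019, §2.2, §3.3] study the transfer operators `L_s` (`s ∈ ℂ`) of the continued
fractions semigroup on the Banach space `C¹(I)`/`L(I)` of regular functions on `I = [0,1]`. Here
we realise the complex transfer operator `cfLC A s` (`CFSemigroupTransferComplex.lean`) as a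
bounded linear operator `cfLOp A hA s : CfLip →L[ℂ] CfLip` on the Banach space `CfLip` of
Lipschitz functions on `[0,1]` (`CFSemigroupLipSpace.lean`), and transfer the a priori bounds:

* `cfLOp_apply`, `cfLOp_pow_apply`: `(L_sⁿ F)(x) = (cfLC A s)^[n] F (x)` on `[0,1]`;
* `norm_cfLOp_le`: `‖L_s‖ ≤ Z(Re s) (2 + 2‖s‖e^{2‖s‖})` with the crude bound
  `Z(σ) = Σ_a (a^{-2σ} + (a+1)^{-2σ})` (`cfZcrude`);
* `norm_cfLOp_pow_le`: for `Re s = σ ≥ 0`, `‖L_sⁿ‖ ≤ 4^σ e^{n P_A(σ)} (3 + 2‖s‖ e^{2‖s‖})`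
  (domination + Lasota–Yorke), so the spectral radius of `L_s` on `CfLip` is at most
  `e^{P_A(Re s)}` ([MageeOhWinter2019, Thm. 10 / Thm. 4]).

## References

* M. Magee, H. Oh, D. Winter, J. reine angew. Math. 753 (2019) 89–135, §2.2, §3.3.
  [MageeOhWinter2019]
-/

noncomputable section

open Set Filter
open scoped Topology

namespace Literature.NumberTheory.Sieve

variable {A : Finset ℕ}

/-! ### Extension of Lipschitz functions on `[0,1]` to `ℝ` -/

namespace CfLip

/-- Extension of `F ∈ CfLip` to `ℝ` (constant outside `[0,1]`). [folklore] -/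
def extend (F : CfLip) : ℝ → ℂ := fun y => F (Set.projIcc 0 1 zero_le_one y)

/-- The extension agrees with `F` on `[0,1]`. [folklore] -/
theorem extend_of_mem (F : CfLip) {y : ℝ} (hy : y ∈ Icc (0 : ℝ) 1) : F.extend y = F ⟨y, hy⟩ := by
  simp only [extend, Set.projIcc_of_mem _ hy]

/-- The extension agrees with `F` at points of `[0,1]`. [folklore] -/
@[simp] theorem extend_coe (F : CfLip) (x : Icc (0 : ℝ) 1) : F.extend x = F x := by
  simp only [extend, Set.projIcc_val]

/-- The extension is bounded by the norm. [folklore] -/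
theorem norm_extend_le (F : CfLip) (y : ℝ) : ‖F.extend y‖ ≤ ‖F‖ := F.norm_apply_le _

/-- The extension is `‖F‖`-Lipschitz on `[0,1]`. [folklore] -/
theorem norm_extend_sub_le (F : CfLip) {x y : ℝ} (hx : x ∈ Icc (0 : ℝ) 1) (hy : y ∈ Icc (0 : ℝ) 1) :
    ‖F.extend x - F.extend y‖ ≤ ‖F‖ * |x - y| := by
  rw [F.extend_of_mem hx, F.extend_of_mem hy]
  exact F.norm_sub_apply_le ⟨x, hx⟩ ⟨y, hy⟩

/-- The extension is additive. [folklore] -/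
theorem extend_add (F G : CfLip) (y : ℝ) : (F + G).extend y = F.extend y + G.extend y := rfl

/-- The extension is homogeneous. [folklore] -/
theorem extend_smul (c : ℂ) (F : CfLip) (y : ℝ) : (c • F).extend y = c * F.extend y := rfl

end CfLip

/-! ### A crude uniform bound for `L_σ 1` -/

variable (A) in
/-- `Z(σ) = Σ_a ((a²)^{-σ} + ((a+1)²)^{-σ})`, a bound for `(L_σ 1)(y)`, `y ∈ [0,1]`, valid for all
real `σ`. [folklore] -/
def cfZcrude (σ : ℝ) : ℝ := ∑ a ∈ A, ((((a : ℝ) ^ 2) ^ (-σ)) + ((((a : ℝ) + 1) ^ 2) ^ (-σ)))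

/-- `Z(σ) ≥ 0`. [folklore] -/
theorem cfZcrude_nonneg (σ : ℝ) : 0 ≤ cfZcrude A σ :=
  Finset.sum_nonneg fun _ _ => add_nonneg (Real.rpow_nonneg (sq_nonneg _) _)
    (Real.rpow_nonneg (sq_nonneg _) _)

/-- `(L_σ 1)(y) ≤ Z(σ)` for `y ∈ [0,1]`. [folklore] -/
theorem cfTransfer_one_le_cfZcrude (hA : ∀ a ∈ A, 1 ≤ a) (σ : ℝ) {y : ℝ} (hy : y ∈ Icc (0 : ℝ) 1) :
    cfTransfer A σ (fun _ => 1) y ≤ cfZcrude A σ := by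
  unfold cfTransfer cfZcrude
  refine Finset.sum_le_sum fun a ha => ?_
  rw [mul_one]
  have ha1 : (1 : ℝ) ≤ a := by exact_mod_cast hA a ha
  have hlo : (a : ℝ) ^ 2 ≤ (y + a) ^ 2 := by nlinarith [hy.1]
  have hhi : (y + a) ^ 2 ≤ ((a : ℝ) + 1) ^ 2 := by nlinarith [hy.1, hy.2]
  have hpos : (0 : ℝ) < (a : ℝ) ^ 2 := by positivity
  have hn1 : 0 ≤ (((a : ℝ) + 1) ^ 2) ^ (-σ) := Real.rpow_nonneg (sq_nonneg _) _
  have hn2 : 0 ≤ ((a : ℝ) ^ 2) ^ (-σ) := Real.rpow_nonneg (sq_nonneg _) _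
  rcases le_or_gt 0 σ with hσ | hσ
  · have h1 : ((y + a) ^ 2) ^ (-σ) ≤ ((a : ℝ) ^ 2) ^ (-σ) :=
      Real.rpow_le_rpow_of_nonpos hpos hlo (by linarith)
    linarith
  · have h1 : ((y + a) ^ 2) ^ (-σ) ≤ (((a : ℝ) + 1) ^ 2) ^ (-σ) :=
      Real.rpow_le_rpow (sq_nonneg _) hhi (by linarith)
    linarith

/-- `L_s` only sees the values on `[0,1]`. [folklore] -/
theorem cfLC_congr (hA : ∀ a ∈ A, 1 ≤ a) (s : ℂ) {g g' : ℝ → ℂ}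
    (h : ∀ y ∈ Icc (0 : ℝ) 1, g y = g' y) {x : ℝ} (hx : x ∈ Icc (0 : ℝ) 1) :
    cfLC A s g x = cfLC A s g' x := by
  unfold cfLC
  exact Finset.sum_congr rfl fun a ha => by rw [h _ (one_div_add_mem_Icc (hA a ha) hx)]

/-! ### The operator -/

variable (A) in
/-- The operator-norm bound constant `Z(Re s)(2 + 2‖s‖e^{2‖s‖})`. [folklore] -/
def cfLOpBound (s : ℂ) : ℝ := cfZcrude A s.re * (2 + 2 * ‖s‖ * Real.exp (2 * ‖s‖))

/-- The bound constant is nonnegative. [folklore] -/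
theorem cfLOpBound_nonneg (s : ℂ) : 0 ≤ cfLOpBound A s :=
  mul_nonneg (cfZcrude_nonneg _) (by positivity)

section Op

variable (A) (hA : ∀ a ∈ A, 1 ≤ a)
include hA

/-- The Lipschitz bound for `x ↦ (L_s F)(x)`. [cite: MageeOhWinter2019, §3.3] -/
theorem cfLC_extend_lip (s : ℂ) (F : CfLip) (x y : Icc (0 : ℝ) 1) :
    ‖cfLC A s F.extend x - cfLC A s F.extend y‖ ≤
      cfZcrude A s.re * ((2 * ‖s‖ * Real.exp (2 * ‖s‖)) * ‖F‖ + ‖F‖) * |(x : ℝ) - y| := by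
  have h := norm_cfLC_iterate_sub_le hA s 1 (f := F.extend) (M := ‖F‖) (L := ‖F‖) (norm_nonneg F)
    (norm_nonneg F) (fun y _ => F.norm_extend_le y) (fun x hx y hy => F.norm_extend_sub_le hx hy)
    x.2 y.2
  simp only [Function.iterate_one, Nat.sub_self, pow_zero, one_mul] at h
  refine h.trans ?_
  rw [mul_assoc (cfZcrude A s.re)]
  exact mul_le_mul_of_nonneg_right (cfTransfer_one_le_cfZcrude hA s.re y.2) (by positivity)

/-- The sup bound for `x ↦ (L_s F)(x)`. [cite: MageeOhWinter2019, §3.3] -/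
theorem norm_cfLC_extend_le (s : ℂ) (F : CfLip) (x : Icc (0 : ℝ) 1) :
    ‖cfLC A s F.extend x‖ ≤ ‖F‖ * cfZcrude A s.re := by
  have h := norm_cfLC_iterate_le_mul hA s 1 (f := F.extend) (M := ‖F‖)
    (fun y _ => F.norm_extend_le y) x.2
  simp only [Function.iterate_one] at h
  exact h.trans (mul_le_mul_of_nonneg_left (cfTransfer_one_le_cfZcrude hA s.re x.2) (norm_nonneg _))

/-- The function `L_s F ∈ CfLip`. [cite: MageeOhWinter2019, §2.2] -/
def cfLOpFun (s : ℂ) (F : CfLip) : CfLip :=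
  CfLip.mk' (fun x => cfLC A s F.extend x)
    (cfZcrude A s.re * ((2 * ‖s‖ * Real.exp (2 * ‖s‖)) * ‖F‖ + ‖F‖)) (cfLC_extend_lip A hA s F)

/-- Pointwise formula for `L_s F`. [folklore] -/
@[simp] theorem cfLOpFun_apply (s : ℂ) (F : CfLip) (x : Icc (0 : ℝ) 1) :
    cfLOpFun A hA s F x = cfLC A s F.extend x := rfl

/-- Norm bound for `L_s F`. [folklore] -/
theorem norm_cfLOpFun_le (s : ℂ) (F : CfLip) : ‖cfLOpFun A hA s F‖ ≤ cfLOpBound A s * ‖F‖ := by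
  have hZ := cfZcrude_nonneg (A := A) s.re
  have h := CfLip.norm_mk'_le (f := fun x : Icc (0 : ℝ) 1 => cfLC A s F.extend x)
    (C := cfZcrude A s.re * ((2 * ‖s‖ * Real.exp (2 * ‖s‖)) * ‖F‖ + ‖F‖)) (M := ‖F‖ * cfZcrude A s.re)
    (by positivity) (cfLC_extend_lip A hA s F) (norm_cfLC_extend_le A hA s F)
  refine h.trans (le_of_eq ?_)
  rw [cfLOpBound]
  ring

/-- **The transfer operator `L_s` on the Lipschitz space `CfLip`** (bounded linear operator).
[cite: MageeOhWinter2019, §2.2] -/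
def cfLOp (s : ℂ) : CfLip →L[ℂ] CfLip :=
  LinearMap.mkContinuous
    { toFun := cfLOpFun A hA s
      map_add' := fun F G => by
        ext x
        simp only [cfLOpFun_apply, CfLip.add_apply, cfLC, ← Finset.sum_add_distrib]
        exact Finset.sum_congr rfl fun a _ => by rw [CfLip.extend_add]; ring
      map_smul' := fun c F => by
        ext x
        simp only [cfLOpFun_apply, CfLip.smul_apply, RingHom.id_apply, cfLC, Finset.mul_sum]
        exact Finset.sum_congr rfl fun a _ => by rw [CfLip.extend_smul]; ring }
    (cfLOpBound A s) fun F => norm_cfLOpFun_le A hA s F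

/-- **Pointwise formula:** `(L_s F)(x) = Σ_a (x+a)^{-2s} F(1/(x+a))`. [cite: MageeOhWinter2019, §2.2] -/
@[simp] theorem cfLOp_apply (s : ℂ) (F : CfLip) (x : Icc (0 : ℝ) 1) :
    cfLOp A hA s F x = cfLC A s F.extend x := rfl

/-- **Operator norm bound:** `‖L_s‖ ≤ Z(Re s)(2 + 2‖s‖ e^{2‖s‖})`. [cite: MageeOhWinter2019, §3.3] -/
theorem norm_cfLOp_le (s : ℂ) : ‖cfLOp A hA s‖ ≤ cfLOpBound A s :=
  LinearMap.mkContinuous_norm_le _ (cfLOpBound_nonneg s) _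

/-- **Iterates:** `(L_sⁿ F)(x) = (cfLC A s)^[n] F (x)` on `[0,1]`. [folklore] -/
theorem cfLOp_pow_apply (s : ℂ) :
    ∀ (n : ℕ) (F : CfLip) (x : Icc (0 : ℝ) 1), ((cfLOp A hA s) ^ n) F x = (cfLC A s)^[n] F.extend x
  | 0, F, x => by simp
  | n + 1, F, x => by
      rw [pow_succ', ContinuousLinearMap.mul_def, ContinuousLinearMap.coe_comp, Function.comp_apply,
        cfLOp_apply, Function.iterate_succ_apply']
      refine cfLC_congr hA s (fun y hy => ?_) x.2
      rw [CfLip.extend_of_mem _ hy]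
      exact cfLOp_pow_apply s n F ⟨y, hy⟩

/-- The extension of `L_sⁿ F` agrees with `(cfLC A s)^[n] F` on `[0,1]`. [folklore] -/
theorem cfLOp_pow_extend (s : ℂ) (n : ℕ) (F : CfLip) {y : ℝ} (hy : y ∈ Icc (0 : ℝ) 1) :
    (((cfLOp A hA s) ^ n) F).extend y = (cfLC A s)^[n] F.extend y := by
  rw [CfLip.extend_of_mem _ hy]
  exact cfLOp_pow_apply A hA s n F ⟨y, hy⟩

/-- **Norm of the iterates** for `Re s ≥ 0`:
`‖L_sⁿ‖ ≤ 4^{Re s} e^{n P_A(Re s)} (3 + 2‖s‖ e^{2‖s‖})` — the spectral radius of `L_s` on the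
Lipschitz space is at most `e^{P_A(Re s)}`. [cite: MageeOhWinter2019, Thm. 10] -/
theorem norm_cfLOp_pow_le (hne : A.Nonempty) {s : ℂ} (hs : 0 ≤ s.re) (n : ℕ) :
    ‖(cfLOp A hA s) ^ n‖ ≤
      (4 : ℝ) ^ s.re * cfEig A s.re ^ n * (3 + 2 * ‖s‖ * Real.exp (2 * ‖s‖)) := by
  have hK : 0 ≤ (4 : ℝ) ^ s.re * cfEig A s.re ^ n := by
    have := cfEig_pos (A := A) s.re
    positivity
  refine ContinuousLinearMap.opNorm_le_bound _ (by positivity) fun F => ?_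
  have hsup : ∀ x : Icc (0 : ℝ) 1, ‖((cfLOp A hA s) ^ n) F x‖ ≤ ‖F‖ * ((4 : ℝ) ^ s.re * cfEig A s.re ^ n) :=
    fun x => by
      rw [cfLOp_pow_apply]
      exact norm_cfLC_iterate_le_of_bound hA hne hs n (norm_nonneg F) (fun y _ => F.norm_extend_le y) x.2
  have hlip : ∀ x y : Icc (0 : ℝ) 1, ‖((cfLOp A hA s) ^ n) F x - ((cfLOp A hA s) ^ n) F y‖ ≤
      (4 : ℝ) ^ s.re * cfEig A s.re ^ n * ((2 * ‖s‖ * Real.exp (2 * ‖s‖) + 2) * ‖F‖) * |(x : ℝ) - y| := by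
    intro x y
    rw [cfLOp_pow_apply, cfLOp_pow_apply]
    have h := norm_cfLC_iterate_sub_le' hA hne hs n (f := F.extend) (M := ‖F‖) (L := ‖F‖)
      (norm_nonneg F) (norm_nonneg F) (fun y _ => F.norm_extend_le y)
      (fun x hx y hy => F.norm_extend_sub_le hx hy) x.2 y.2
    refine h.trans ?_
    have hhalf : (1 / 2 : ℝ) ^ (n - 1) ≤ 2 :=
      (pow_le_one₀ (by norm_num) (by norm_num)).trans (by norm_num)
    have h2 : 2 * ‖s‖ * Real.exp (2 * ‖s‖) * ‖F‖ + (1 / 2 : ℝ) ^ (n - 1) * ‖F‖ ≤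
        (2 * ‖s‖ * Real.exp (2 * ‖s‖) + 2) * ‖F‖ := by
      nlinarith [norm_nonneg F]
    calc (4 : ℝ) ^ s.re * cfEig A s.re ^ n *
          ((2 * ‖s‖ * Real.exp (2 * ‖s‖) * ‖F‖ + (1 / 2 : ℝ) ^ (n - 1) * ‖F‖) * |(x : ℝ) - y|)
        ≤ (4 : ℝ) ^ s.re * cfEig A s.re ^ n *
            (((2 * ‖s‖ * Real.exp (2 * ‖s‖) + 2) * ‖F‖) * |(x : ℝ) - y|) :=
          mul_le_mul_of_nonneg_left (mul_le_mul_of_nonneg_right h2 (abs_nonneg _)) hK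
      _ = _ := by ring
  calc ‖((cfLOp A hA s) ^ n) F‖
      ≤ ‖F‖ * ((4 : ℝ) ^ s.re * cfEig A s.re ^ n) +
          (4 : ℝ) ^ s.re * cfEig A s.re ^ n * ((2 * ‖s‖ * Real.exp (2 * ‖s‖) + 2) * ‖F‖) :=
        CfLip.norm_le_of_bounds (by positivity) hsup hlip
    _ = (4 : ℝ) ^ s.re * cfEig A s.re ^ n * (3 + 2 * ‖s‖ * Real.exp (2 * ‖s‖)) * ‖F‖ := by ring

end Op

end Literature.NumberTheory.Sieve
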